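import Summits.HubbardSuperconductivity.HubbardSuperconductivity.Theorems.WeakCouplingBCSDefsKlCertTPrime
import Summits.HubbardSuperconductivity.HubbardSuperconductivity.Theorems.WeakCouplingBCSKlCertTPrimePHReflectionMeasure

/-!
# KL-MARGIN-SCAN reader hubbard-klscan-idea-4 (lens «cascade»), round 8 — LEVEL MOTION:
# the van Hove-referenced Fermi level `μ(δ; t′) − 4t′` is monotone in `t′` along every iso-density line
# (crux idea «iso-density-level-motion» on `stmt-HubbardSuperconductivity-0158`)

The `(δ, t′)` scan of the second-order Kohn–Luttinger vertex («KL-MARGIN-SCAN», director-hubbard g16, cell INBOX l.280;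
SCAN-TABLE v0–v0.2 of margin-1 g14) is organised by ONE signed length, the van Hove-referenced Fermi level
`d̃(δ; t′) := μ(δ; t′) − 4t′` (`vhLevel`; `Γ`-side iff `d̃ < 0`, `M`-side iff `d̃ > 0`, VH-EXCLUDED iff `|d̃| < 1/40` =
`klVHExcludedTP`).  Every TPRIME row, round 7's branch-wise shape hypothesis on `δ = ⅛` and idea-3's charted segments need the
SIDE and the admissibility of cells and of whole `t′`-intervals — so far a cell-by-cell filling certificate.  This file proves the
side bookkeeping from one pointwise identity of the band, `ε_{t′}(k) − 4t′ = ε₀(k) − 4t′(1 + cos k₀ cos k₁)` with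
`0 ≤ 1 + cos k₀ cos k₁` (§1: `t′ ↦ ε_{t′}(k) − 4t′` antitone, `t′ ↦ ε_{t′}(k) + 4t′` monotone, for every `k`), by quantile
monotonicity (the filling is the distribution function of `ε_{t′}` over the zone, `μ(n; t′)` its quantile; §2–§4):
* `filling_vhRef_monotone` / `filling_topRef_antitone`: `t′ ↦ n[ε_{t′}](±4t′ + d)` is monotone / antitone for every offset `d`;
  hence **the van Hove doping `δ_VH(t′)` is antitone in `t′`** (`vanHoveDoping_antitone`; the scan's `0 / 0.082 / 0.170 / 0.274`
  at `t′ = 0 / −0.1 / −0.2 / −0.3` instantiate the ORDER; the values stay floats);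
* `muOfDoping_sub_vh_antitone` / `muOfDoping_add_vh_monotone`: at fixed `δ ∈ [−1, 1)`, `t′ ↦ μ(δ; t′) ∓ 4t′` is antitone /
  monotone; hence **`μ(δ; ·)` is 4-Lipschitz in `t′`** (`muOfDoping_lipschitz`) and `d̃(δ; ·)` is antitone (`vhLevel_antitone`);
* §5: `M`-sidedness `c ≤ d̃` propagates to every smaller `t′`, `Γ`-sidedness `d̃ ≤ −c` to every larger `t′`; the crossing set
  `{t′ | d̃ = 0}` is order-connected; two tube-edge facts `d̃(δ; t_M) ≥ 1/40`, `d̃(δ; t_Γ) ≤ −1/40` confine the VH-excluded `t′`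
  of a line to `(t_M, t_Γ)` and make `(−∞, t_M]` / `[t_Γ, ∞)` the `M`- / `Γ`-admissible branches (`branches_of_edges`); literal
  readings for `δ = ⅛` (`t_M = −9/50`, `t_Γ = −3/25`) and for the one-branch lines `δ = 3/10, 7/20`.

Honest framing.  Free-band bookkeeping only (order facts about the filling and its quantile); floats in docstrings are margin-1's
(scan_float.json 846515b46af87fa7) and are not asserted.  STRICT monotonicity (hence «exactly one van Hove crossing per line») is
NOT proved — it needs strict monotonicity of the `t′ ≠ 0` filling across the band, in the tree at `t′ = 0` only
(`strictMonoOn_filling`).  Nothing here asserts a Kohn–Luttinger margin at any `t′`, K₃, `U₀`, the window or superconductivity;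
a Kohn–Luttinger `O(U²)` channel statement is not ODLRO and nothing here proves superconductivity in the Hubbard model; no
`t′ ≠ 0` statement chains to the summit Statement (`squareDispersion 1 0`).  Zero kit.

References: S. Raghu, S. A. Kivelson, D. J. Scalapino, Phys. Rev. B 81 (2010) 224505, §II (4), §III (`|μ − 4t′|` as the organising
scale; arXiv:1002.0591); R. Hlubina, S. Sorella, F. Guinea, Phys. Rev. Lett. 78 (1997) 1343, p. 2 (VH level `∓4t′`, the VH density as
a function of `t′/t`; arXiv:cond-mat/9609253); B. Kawohl, *Rearrangements and Convexity of Level Sets in PDE*, LNM 1150 (1985),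
p. 17 (O), (M2) (rearrangement is order preserving and commutes with constants); tree `Theorems/WeakCouplingBCSDefsKlCertTPrime`
(p665271 §3: `klMuOfDopingTP`, `klDopingOfMuTP`, `klVanHoveLevelTP`, `klVanHoveDopingTP`, `klVHExcludedTP`),
`Theorems/WeakCouplingBCSKlCertTPrimePHReflectionMeasure` (`klph_integrableOn_fermiOccupation`, `klph_volume_brillouinZone_toReal`).
AI-produced formalisation (H21, cell gate-hubbard-kl, seat hubbard-klscan-idea-4 g8, 2026-08-29).
-/

noncomputable section

set_option linter.dupNamespace false

namespace Summit.HubbardSuperconductivity.HubbardSuperconductivity.Theorems.KlLevelMotion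

open Real Set MeasureTheory Literature.MathematicalPhysics.QuantumLattice
open Summit.HubbardSuperconductivity.HubbardSuperconductivity.Theorems

/-! ### §1  The van Hove-referenced band `ε_{t′} − 4t′` and its mirror `ε_{t′} + 4t′` -/

/-- `ε_{t′}(k) − 4t′ = ε₀(k) − 4t′ (1 + cos k₀ cos k₁)`: referenced to the van Hove level `4t′`, the `t′`-dependence of the band
carries the non-negative weight `1 + cos k₀ cos k₁` (which vanishes exactly at the saddles). [folklore] -/
theorem vhRef_apply (tp : ℝ) (k : Momentum) :
    squareDispersion 1 tp k - 4 * tp = squareDispersion 1 0 k - 4 * tp * (1 + cos (k 0) * cos (k 1)) := by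
  simp only [squareDispersion]; ring

/-- `ε_{t′}(k) + 4t′ = ε₀(k) + 4t′ (1 − cos k₀ cos k₁)` (the mirror reference, weight `1 − cos k₀ cos k₁ ≥ 0`). [folklore] -/
theorem topRef_apply (tp : ℝ) (k : Momentum) :
    squareDispersion 1 tp k + 4 * tp = squareDispersion 1 0 k + 4 * tp * (1 - cos (k 0) * cos (k 1)) := by
  simp only [squareDispersion]; ring

/-- `|cos k₀ cos k₁| ≤ 1`. [folklore] -/
theorem abs_cos_mul_cos_le (k : Momentum) : |cos (k 0) * cos (k 1)| ≤ 1 := by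
  rw [abs_mul]
  exact mul_le_one₀ (abs_cos_le_one _) (abs_nonneg _) (abs_cos_le_one _)

/-- **`t′ ↦ ε_{t′}(k) − 4t′` is antitone** for every momentum `k`. [folklore] -/
theorem vhRef_antitone (k : Momentum) : Antitone (fun tp : ℝ => squareDispersion 1 tp k - 4 * tp) := by
  intro a b hab
  have hw : 0 ≤ 1 + cos (k 0) * cos (k 1) := by linarith [(abs_le.1 (abs_cos_mul_cos_le k)).1]
  show squareDispersion 1 b k - 4 * b ≤ squareDispersion 1 a k - 4 * a
  rw [vhRef_apply, vhRef_apply]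
  nlinarith [mul_le_mul_of_nonneg_right hab hw]

/-- **`t′ ↦ ε_{t′}(k) + 4t′` is monotone** for every momentum `k`. [folklore] -/
theorem topRef_monotone (k : Momentum) : Monotone (fun tp : ℝ => squareDispersion 1 tp k + 4 * tp) := by
  intro a b hab
  have hw : 0 ≤ 1 - cos (k 0) * cos (k 1) := by linarith [(abs_le.1 (abs_cos_mul_cos_le k)).2]
  show squareDispersion 1 a k + 4 * a ≤ squareDispersion 1 b k + 4 * b
  rw [topRef_apply, topRef_apply]
  nlinarith [mul_le_mul_of_nonneg_right hab hw]

/-- Band bounds: `|ε_{t′}(k)| ≤ 4 + 4|t′|`. [folklore] -/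
theorem abs_squareDispersion_le (tp : ℝ) (k : Momentum) : |squareDispersion 1 tp k| ≤ 4 + 4 * |tp| := by
  have h0 := abs_le.1 (abs_cos_le_one (k 0))
  have h1 := abs_le.1 (abs_cos_le_one (k 1))
  have hp : |tp * (cos (k 0) * cos (k 1))| ≤ |tp| := by
    rw [abs_mul]
    exact mul_le_of_le_one_right (abs_nonneg _) (abs_cos_mul_cos_le k)
  have hp' := abs_le.1 hp
  have hform : squareDispersion 1 tp k = -2 * (cos (k 0) + cos (k 1)) - 4 * (tp * (cos (k 0) * cos (k 1))) := by
    simp only [squareDispersion]; ring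
  rw [hform, abs_le]
  constructor <;> linarith

/-! ### §2  The filling: monotone under the pointwise order of `ε − μ`; range `[0, 2]`; empty and full band -/

/-- Pointwise: if `ε₂ − μ₂ ≤ ε₁ − μ₁` everywhere then the Fermi sea of `(ε₁, μ₁)` lies in that of `(ε₂, μ₂)`,
`f[ε₁, μ₁] ≤ f[ε₂, μ₂]`. [folklore] -/
theorem fermiOccupation_le_of_level {ε₁ ε₂ : Momentum → ℝ} {μ₁ μ₂ : ℝ}
    (h : ∀ p, ε₂ p - μ₂ ≤ ε₁ p - μ₁) (p : Momentum) :
    fermiOccupation ε₁ μ₁ p ≤ fermiOccupation ε₂ μ₂ p := by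
  unfold fermiOccupation
  by_cases h1 : ε₁ p < μ₁
  · have h2 : ε₂ p < μ₂ := by linarith [h p]
    rw [if_pos h1, if_pos h2]
  · rw [if_neg h1]
    split_ifs <;> norm_num

/-- **Quantile monotonicity of the filling**: `ε_{t′₂} − μ₂ ≤ ε_{t′₁} − μ₁` pointwise implies
`n[ε_{t′₁}](μ₁) ≤ n[ε_{t′₂}](μ₂)`. [cite: LiebLoss2001, ch. 3] -/
theorem filling_le_of_level (t : ℝ) {tp₁ tp₂ μ₁ μ₂ : ℝ}
    (h : ∀ p, squareDispersion t tp₂ p - μ₂ ≤ squareDispersion t tp₁ p - μ₁) :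
    KohnLuttinger.filling (squareDispersion t tp₁) μ₁ ≤ KohnLuttinger.filling (squareDispersion t tp₂) μ₂ := by
  unfold KohnLuttinger.filling
  have hπ : 0 < (2 * π) ^ 2 := by positivity
  apply div_le_div_of_nonneg_right _ hπ.le
  refine mul_le_mul_of_nonneg_left ?_ (by norm_num)
  exact setIntegral_mono (klph_integrableOn_fermiOccupation t tp₁ μ₁) (klph_integrableOn_fermiOccupation t tp₂ μ₂)
    (fun p => fermiOccupation_le_of_level h p)

/-- The filling of the `t`–`t′` band is monotone in the chemical potential (general-`t′` twin of `monotone_filling`). [folklore] -/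
theorem filling_monotone (t tp : ℝ) : Monotone (KohnLuttinger.filling (squareDispersion t tp)) :=
  fun _ _ hab => filling_le_of_level t (fun _ => by linarith)

/-- **The filling at VH-referenced level is monotone in `t′`**: `t′ ↦ n[ε_{t′}](4t′ + d)` is monotone for every offset `d`
(the sublevel sets of the antitone family `ε_{t′} − 4t′` grow with `t′`). [folklore] -/
theorem filling_vhRef_monotone (d : ℝ) :
    Monotone (fun tp : ℝ => KohnLuttinger.filling (squareDispersion 1 tp) (klVanHoveLevelTP tp + d)) := by
  intro a b hab
  apply filling_le_of_level 1
  intro p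
  have h := vhRef_antitone p hab
  simp only [klVanHoveLevelTP] at h ⊢
  linarith

/-- **The filling at the mirror-referenced level is antitone in `t′`**: `t′ ↦ n[ε_{t′}](−4t′ + d)` is antitone for every `d`. [folklore] -/
theorem filling_topRef_antitone (d : ℝ) :
    Antitone (fun tp : ℝ => KohnLuttinger.filling (squareDispersion 1 tp) (-klVanHoveLevelTP tp + d)) := by
  intro a b hab
  apply filling_le_of_level 1
  intro p
  have h := topRef_monotone p hab
  simp only [klVanHoveLevelTP] at h ⊢
  linarith

/-- `0 ≤ n[ε_{t′}](μ)`. [folklore] -/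
theorem filling_nonneg (t tp μ : ℝ) : 0 ≤ KohnLuttinger.filling (squareDispersion t tp) μ := by
  unfold KohnLuttinger.filling
  have : 0 ≤ ∫ p in brillouinZone, fermiOccupation (squareDispersion t tp) μ p :=
    setIntegral_nonneg measurableSet_brillouinZone fun p _ => by
      unfold fermiOccupation; split_ifs <;> norm_num
  positivity

/-- `n[ε_{t′}](μ) ≤ 2` (`vol(BZ) = (2π)²`). [folklore] -/
theorem filling_le_two (t tp μ : ℝ) : KohnLuttinger.filling (squareDispersion t tp) μ ≤ 2 := by
  unfold KohnLuttinger.filling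
  have hi1 : IntegrableOn (fun _ : Momentum => (1 : ℝ)) brillouinZone volume :=
    integrableOn_const volume_brillouinZone_lt_top.ne
  have h1 : ∫ p in brillouinZone, fermiOccupation (squareDispersion t tp) μ p ≤ ∫ _ in brillouinZone, (1 : ℝ) :=
    setIntegral_mono (klph_integrableOn_fermiOccupation t tp μ) hi1 (fun p => by
      show fermiOccupation (squareDispersion t tp) μ p ≤ 1; unfold fermiOccupation; split_ifs <;> norm_num)
  rw [setIntegral_const, smul_eq_mul, mul_one, measureReal_def, klph_volume_brillouinZone_toReal] at h1
  rw [div_le_iff₀ (by positivity : 0 < (2 * π) ^ 2)]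
  linarith

/-- Below the band the Fermi sea is empty: `n[ε_{t′}](μ) = 0` for `μ ≤ −(4 + 4|t′|)`. [folklore] -/
theorem filling_of_le_bot {tp μ : ℝ} (hμ : μ ≤ -(4 + 4 * |tp|)) :
    KohnLuttinger.filling (squareDispersion 1 tp) μ = 0 := by
  unfold KohnLuttinger.filling
  have h0 : ∫ p in brillouinZone, fermiOccupation (squareDispersion 1 tp) μ p = 0 := by
    refine setIntegral_eq_zero_of_forall_eq_zero fun p _ => ?_
    unfold fermiOccupation
    have := (abs_le.1 (abs_squareDispersion_le tp p)).1
    rw [if_neg (by linarith)]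
  rw [h0]; simp

/-- Above the band the Fermi sea is the whole zone: `n[ε_{t′}](μ) = 2` for `4 + 4|t′| < μ`. [folklore] -/
theorem filling_of_top_lt {tp μ : ℝ} (hμ : 4 + 4 * |tp| < μ) :
    KohnLuttinger.filling (squareDispersion 1 tp) μ = 2 := by
  unfold KohnLuttinger.filling
  have h1 : ∫ p in brillouinZone, fermiOccupation (squareDispersion 1 tp) μ p = ∫ _ in brillouinZone, (1 : ℝ) := by
    refine setIntegral_congr_fun measurableSet_brillouinZone fun p _ => ?_
    unfold fermiOccupation
    have := (abs_le.1 (abs_squareDispersion_le tp p)).2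
    rw [if_pos (by linarith)]
  rw [h1, setIntegral_const, smul_eq_mul, mul_one, measureReal_def, klph_volume_brillouinZone_toReal]
  have hπ : (2 * π) ^ 2 ≠ 0 := by positivity
  field_simp

/-! ### §3  Dopings: `δ(4t′ + d; t′)` antitone in `t′`; the van Hove doping `δ_VH(t′)` antitone -/

/-- The hole doping at VH-referenced level, `t′ ↦ δ(4t′ + d; t′)`, is antitone in `t′`. [folklore] -/
theorem dopingOfMu_vhRef_antitone (d : ℝ) :
    Antitone (fun tp : ℝ => klDopingOfMuTP tp (klVanHoveLevelTP tp + d)) := by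
  intro a b hab
  have h := filling_vhRef_monotone d hab
  show klDopingOfMuTP b (klVanHoveLevelTP b + d) ≤ klDopingOfMuTP a (klVanHoveLevelTP a + d)
  unfold klDopingOfMuTP
  simp only at h
  linarith

/-- **The van Hove doping `δ_VH(t′) = δ(4t′; t′)` is antitone in `t′`**: it grows as `t′` decreases (scan floats
`0 / 0.082 / 0.170 / 0.274` at `t′ = 0 / −0.1 / −0.2 / −0.3`, not asserted; their ORDER is this theorem). [folklore] -/
theorem vanHoveDoping_antitone : Antitone klVanHoveDopingTP := by
  intro a b hab
  have h := dopingOfMu_vhRef_antitone 0 hab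
  simpa [klVanHoveDopingTP] using h

/-! ### §4  The chemical potential at fixed doping: `μ(δ; t′) − 4t′` antitone, `μ(δ; t′) + 4t′` monotone, `μ(δ; ·)` 4-Lipschitz -/

/-- The superlevel set `{μ | n ≤ n[ε_{t′}](μ)}` (whose infimum is `μ(n; t′)`) is non-empty for `n ≤ 2`. [folklore] -/
theorem fillingSet_nonempty (tp : ℝ) {n : ℝ} (hn : n ≤ 2) :
    {μ : ℝ | n ≤ KohnLuttinger.filling (squareDispersion 1 tp) μ}.Nonempty :=
  ⟨4 + 4 * |tp| + 1, by simp only [mem_setOf_eq]; rw [filling_of_top_lt (by linarith)]; exact hn⟩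

/-- The superlevel set `{μ | n ≤ n[ε_{t′}](μ)}` is bounded below (by the band bottom) for `0 < n`. [folklore] -/
theorem fillingSet_bddBelow (tp : ℝ) {n : ℝ} (hn : 0 < n) :
    BddBelow {μ : ℝ | n ≤ KohnLuttinger.filling (squareDispersion 1 tp) μ} := by
  refine ⟨-(4 + 4 * |tp|), fun μ hμ => ?_⟩
  by_contra hlt
  have h0 := filling_of_le_bot (lt_of_not_ge hlt).le
  simp only [mem_setOf_eq] at hμ
  linarith

/-- **Level motion, VH reference**: at fixed hole doping `δ ∈ [−1, 1)`, `t′ ↦ μ(δ; t′) − 4t′` is ANTITONE — the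
VH-referenced Fermi level rises as `t′` decreases along every iso-density line. [folklore] -/
theorem muOfDoping_sub_vh_antitone {δ : ℝ} (h1 : δ < 1) (h2 : -1 ≤ δ) :
    Antitone (fun tp : ℝ => klMuOfDopingTP tp δ - klVanHoveLevelTP tp) := by
  intro a b hab
  have hn0 : 0 < 1 - δ := by linarith
  have hn2 : 1 - δ ≤ 2 := by linarith
  have key : ∀ m ∈ {μ : ℝ | 1 - δ ≤ KohnLuttinger.filling (squareDispersion 1 a) μ},
      chemicalPotentialOfDensity (squareDispersion 1 b) (1 - δ) ≤ m + 4 * (b - a) := by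
    intro m hm
    unfold chemicalPotentialOfDensity
    refine csInf_le (fillingSet_bddBelow b hn0) ?_
    have hmono := filling_vhRef_monotone (m - 4 * a) hab
    simp only [klVanHoveLevelTP] at hmono
    rw [show 4 * a + (m - 4 * a) = m by ring, show 4 * b + (m - 4 * a) = m + 4 * (b - a) by ring] at hmono
    exact le_trans hm hmono
  have hle : chemicalPotentialOfDensity (squareDispersion 1 b) (1 - δ) - 4 * (b - a) ≤
      chemicalPotentialOfDensity (squareDispersion 1 a) (1 - δ) := by
    unfold chemicalPotentialOfDensity
    refine le_csInf (fillingSet_nonempty a hn2) fun m hm => ?_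
    have := key m hm
    unfold chemicalPotentialOfDensity at this
    linarith
  show klMuOfDopingTP b δ - klVanHoveLevelTP b ≤ klMuOfDopingTP a δ - klVanHoveLevelTP a
  simp only [klMuOfDopingTP, klVanHoveLevelTP]
  linarith

/-- **Level motion, mirror reference**: at fixed `δ ∈ [−1, 1)`, `t′ ↦ μ(δ; t′) + 4t′` is MONOTONE. [folklore] -/
theorem muOfDoping_add_vh_monotone {δ : ℝ} (h1 : δ < 1) (h2 : -1 ≤ δ) :
    Monotone (fun tp : ℝ => klMuOfDopingTP tp δ + klVanHoveLevelTP tp) := by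
  intro a b hab
  have hn0 : 0 < 1 - δ := by linarith
  have hn2 : 1 - δ ≤ 2 := by linarith
  have key : ∀ m ∈ {μ : ℝ | 1 - δ ≤ KohnLuttinger.filling (squareDispersion 1 b) μ},
      chemicalPotentialOfDensity (squareDispersion 1 a) (1 - δ) ≤ m + 4 * (b - a) := by
    intro m hm
    unfold chemicalPotentialOfDensity
    refine csInf_le (fillingSet_bddBelow a hn0) ?_
    have hanti := filling_topRef_antitone (m + 4 * b) hab
    simp only [klVanHoveLevelTP] at hanti
    rw [show -(4 * b) + (m + 4 * b) = m by ring, show -(4 * a) + (m + 4 * b) = m + 4 * (b - a) by ring] at hanti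
    exact le_trans hm hanti
  have hle : chemicalPotentialOfDensity (squareDispersion 1 a) (1 - δ) - 4 * (b - a) ≤
      chemicalPotentialOfDensity (squareDispersion 1 b) (1 - δ) := by
    unfold chemicalPotentialOfDensity
    refine le_csInf (fillingSet_nonempty b hn2) fun m hm => ?_
    have := key m hm
    unfold chemicalPotentialOfDensity at this
    linarith
  show klMuOfDopingTP a δ + klVanHoveLevelTP a ≤ klMuOfDopingTP b δ + klVanHoveLevelTP b
  simp only [klMuOfDopingTP, klVanHoveLevelTP]
  linarith

/-- **`μ(δ; ·)` is 4-Lipschitz in `t′`** at every fixed `δ ∈ [−1, 1)`: `|μ(δ; a) − μ(δ; b)| ≤ 4|a − b|`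
(so a certified `μ`-bracket at one `t′` node is a bracket of half-width `4h` at the nodes `t′ ± h`). [folklore] -/
theorem muOfDoping_lipschitz {δ : ℝ} (h1 : δ < 1) (h2 : -1 ≤ δ) (a b : ℝ) :
    |klMuOfDopingTP a δ - klMuOfDopingTP b δ| ≤ 4 * |a - b| := by
  rcases le_total a b with hab | hba
  · have hA := muOfDoping_sub_vh_antitone h1 h2 hab; have hM := muOfDoping_add_vh_monotone h1 h2 hab
    simp only [klVanHoveLevelTP] at hA hM
    rw [abs_of_nonpos (by linarith : a - b ≤ 0), abs_le]; constructor <;> linarith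
  · have hA := muOfDoping_sub_vh_antitone h1 h2 hba; have hM := muOfDoping_add_vh_monotone h1 h2 hba
    simp only [klVanHoveLevelTP] at hA hM
    rw [abs_of_nonneg (by linarith : 0 ≤ a - b), abs_le]; constructor <;> linarith

/-! ### §5  Side bookkeeping of an iso-density line from two facts -/

/-- **The signed van Hove-referenced Fermi level of the cell `(δ, t′)`**, `d̃(δ; t′) := μ(δ; t′) − 4t′` (`Γ`-side iff `< 0`,
`M`-side iff `> 0`; `|d̃| < 1/40` = `klVHExcludedTP`); float along `δ = ⅛`: `−0.237` (`t′ = 0`) ↗ `+0.240` (`t′ = −0.3`),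
one zero at `t′* ≈ −0.150` (not asserted). [cite: RaghuKivelsonScalapino2010, §III] -/
def vhLevel (tp δ : ℝ) : ℝ := klMuOfDopingTP tp δ - klVanHoveLevelTP tp

/-- The scan's VH exclusion is `|d̃| < 1/40`. [folklore] -/
theorem vhExcluded_iff (tp δ : ℝ) : klVHExcludedTP tp δ ↔ |vhLevel tp δ| < 1 / 40 := Iff.rfl

/-- **`d̃(δ; ·)` is antitone in `t′`** on every iso-density line `δ ∈ [−1, 1)`. [folklore] -/
theorem vhLevel_antitone {δ : ℝ} (h1 : δ < 1) (h2 : -1 ≤ δ) : Antitone (fun tp : ℝ => vhLevel tp δ) :=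
  muOfDoping_sub_vh_antitone h1 h2

/-- **`M`-sidedness propagates to smaller `t′`**: if `c ≤ d̃(δ; b)` then `c ≤ d̃(δ; a)` for every `a ≤ b`. [folklore] -/
theorem Mside_propagates {δ c a b : ℝ} (h1 : δ < 1) (h2 : -1 ≤ δ) (hab : a ≤ b) (h : c ≤ vhLevel b δ) :
    c ≤ vhLevel a δ :=
  h.trans (vhLevel_antitone h1 h2 hab)

/-- **`Γ`-sidedness propagates to larger `t′`**: if `d̃(δ; a) ≤ −c` then `d̃(δ; b) ≤ −c` for every `a ≤ b`. [folklore] -/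
theorem Gside_propagates {δ c a b : ℝ} (h1 : δ < 1) (h2 : -1 ≤ δ) (hab : a ≤ b) (h : vhLevel a δ ≤ -c) :
    vhLevel b δ ≤ -c :=
  (vhLevel_antitone h1 h2 hab).trans h

/-- The `M`-admissible part `{t′ | 1/40 ≤ d̃(δ; t′)}` of a line is a LOWER set (an initial ray of the line). [folklore] -/
theorem isLowerSet_Madmissible {δ : ℝ} (h1 : δ < 1) (h2 : -1 ≤ δ) (c : ℝ) :
    IsLowerSet {tp : ℝ | c ≤ vhLevel tp δ} :=
  fun _ _ hab h => Mside_propagates h1 h2 hab h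

/-- The `Γ`-admissible part `{t′ | d̃(δ; t′) ≤ −1/40}` of a line is an UPPER set (a final ray of the line). [folklore] -/
theorem isUpperSet_Gadmissible {δ : ℝ} (h1 : δ < 1) (h2 : -1 ≤ δ) (c : ℝ) :
    IsUpperSet {tp : ℝ | vhLevel tp δ ≤ -c} :=
  fun _ _ hab h => Gside_propagates h1 h2 hab h

/-- **The van Hove crossing set `{t′ | d̃(δ; t′) = 0}` of an iso-density line is order-connected** (an interval, possibly
empty; a single point once strict monotonicity is available). [folklore] -/
theorem ordConnected_vhCrossing {δ : ℝ} (h1 : δ < 1) (h2 : -1 ≤ δ) :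
    OrdConnected {tp : ℝ | vhLevel tp δ = 0} := by
  refine ⟨fun a ha b hb x hx => ?_⟩
  simp only [mem_setOf_eq] at ha hb ⊢
  have hxa := vhLevel_antitone h1 h2 hx.1
  have hbx := vhLevel_antitone h1 h2 hx.2
  simp only at hxa hbx
  linarith

/-- Not excluded and on the `M` side at every `t′ ≤ t_M` once `1/40 ≤ d̃(δ; t_M)`. [folklore] -/
theorem not_excluded_of_Medge {δ tM tp : ℝ} (h1 : δ < 1) (h2 : -1 ≤ δ) (hM : 1 / 40 ≤ vhLevel tM δ) (htp : tp ≤ tM) :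
    ¬ klVHExcludedTP tp δ ∧ 1 / 40 ≤ vhLevel tp δ := by
  have h := Mside_propagates h1 h2 htp hM
  refine ⟨fun hx => ?_, h⟩
  linarith [(abs_lt.1 ((vhExcluded_iff _ _).1 hx)).2]

/-- Not excluded and on the `Γ` side at every `t′ ≥ t_Γ` once `d̃(δ; t_Γ) ≤ −1/40`. [folklore] -/
theorem not_excluded_of_Gedge {δ tG tp : ℝ} (h1 : δ < 1) (h2 : -1 ≤ δ) (hG : vhLevel tG δ ≤ -(1 / 40)) (htp : tG ≤ tp) :
    ¬ klVHExcludedTP tp δ ∧ vhLevel tp δ ≤ -(1 / 40) := by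
  have h := Gside_propagates h1 h2 htp hG
  refine ⟨fun hx => ?_, h⟩
  linarith [(abs_lt.1 ((vhExcluded_iff _ _).1 hx)).1]

/-- **Two tube-edge facts confine the VH-excluded `t′` of a line to the open interval between them**: if
`1/40 ≤ d̃(δ; t_M)` and `d̃(δ; t_Γ) ≤ −1/40` then every VH-excluded `t′` of the line lies in `(t_M, t_Γ)`. [folklore] -/
theorem excluded_mem_Ioo_of_edges {δ tM tG tp : ℝ} (h1 : δ < 1) (h2 : -1 ≤ δ)
    (hM : 1 / 40 ≤ vhLevel tM δ) (hG : vhLevel tG δ ≤ -(1 / 40)) (hx : klVHExcludedTP tp δ) :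
    tp ∈ Ioo tM tG := by
  constructor
  · by_contra hle
    exact (not_excluded_of_Medge h1 h2 hM (le_of_not_gt hle)).1 hx
  · by_contra hle
    exact (not_excluded_of_Gedge h1 h2 hG (le_of_not_gt hle)).1 hx

/-- **Branch intervals**: with the two tube-edge facts, `t′ ≤ t_M` ⇒ `M`-side admissible, `t_Γ ≤ t′` ⇒ `Γ`-side admissible, and
the VH tube sits strictly between (the shape on which a branch-wise hypothesis — round 7's K1 — should be typed). [folklore] -/
theorem branches_of_edges {δ tM tG : ℝ} (h1 : δ < 1) (h2 : -1 ≤ δ)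
    (hM : 1 / 40 ≤ vhLevel tM δ) (hG : vhLevel tG δ ≤ -(1 / 40)) :
    (∀ tp ≤ tM, ¬ klVHExcludedTP tp δ ∧ 1 / 40 ≤ vhLevel tp δ) ∧
    (∀ tp ≥ tG, ¬ klVHExcludedTP tp δ ∧ vhLevel tp δ ≤ -(1 / 40)) ∧
    (∀ tp, klVHExcludedTP tp δ → tp ∈ Ioo tM tG) :=
  ⟨fun _ htp => not_excluded_of_Medge h1 h2 hM htp, fun _ htp => not_excluded_of_Gedge h1 h2 hG htp,
    fun _ hx => excluded_mem_Ioo_of_edges h1 h2 hM hG hx⟩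

/-- **The `δ = ⅛` line from two facts** (the numbers of round 7 / idea-3 r7: `t_M = −9/50`, `t_Γ = −3/25`; float
`d̃(⅛; −9/50) = +0.0346`, `d̃(⅛; −3/25) = −0.0353`, not asserted): every `t′ ∈ [−3/25, 0]` is `Γ`-side admissible (the segment of
`KlVertexPropagation.SegmentRow_d0125_G` has constant side), every `t′ ∈ [−3/10, −9/50]` is `M`-side admissible
(`SegmentRow_d0125_M`), and the VH-excluded `t′` of the line — in particular both excluded scan nodes `−0.16`, `−0.14` and the
crossing `t′*` — lie in `(−9/50, −3/25)`. [folklore] -/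
theorem line_d0125_zones_of_edges (hM : 1 / 40 ≤ vhLevel (-9 / 50) (1 / 8)) (hG : vhLevel (-3 / 25) (1 / 8) ≤ -(1 / 40)) :
    (∀ tp ∈ Icc (-3 / 25 : ℝ) 0, ¬ klVHExcludedTP tp (1 / 8) ∧ vhLevel tp (1 / 8) ≤ -(1 / 40)) ∧
    (∀ tp ∈ Icc (-3 / 10 : ℝ) (-9 / 50), ¬ klVHExcludedTP tp (1 / 8) ∧ 1 / 40 ≤ vhLevel tp (1 / 8)) ∧
    (∀ tp, klVHExcludedTP tp (1 / 8) → tp ∈ Ioo (-9 / 50 : ℝ) (-3 / 25)) :=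
  ⟨fun _ htp => not_excluded_of_Gedge (by norm_num) (by norm_num) hG htp.1,
    fun _ htp => not_excluded_of_Medge (by norm_num) (by norm_num) hM htp.2,
    fun _ hx => excluded_mem_Ioo_of_edges (by norm_num) (by norm_num) hM hG hx⟩

/-- **One fact decides the `δ = 7/20` line.**  If the cell `(7/20, −3/10)` is `Γ`-side by at least the exclusion width
(float `d̃ = −0.102`, not asserted), then EVERY `t′ ∈ [−3/10, 0]` of the iso-density line `δ = 7/20` is `Γ`-side and
admissible — the line never meets the van Hove tube, and its segment statement has a single branch. [folklore] -/
theorem line_d035_all_Gamma_of_edge (hedge : vhLevel (-3 / 10) (7 / 20) ≤ -(1 / 40)) :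
    ∀ tp ∈ Icc (-3 / 10 : ℝ) 0, ¬ klVHExcludedTP tp (7 / 20) ∧ vhLevel tp (7 / 20) ≤ -(1 / 40) :=
  fun _ htp => not_excluded_of_Gedge (by norm_num) (by norm_num) hedge htp.1

end Summit.HubbardSuperconductivity.HubbardSuperconductivity.Theorems.KlLevelMotion

end
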